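import Summits.BirchSwinnertonDyer.Rank2.LambdaDoorKernelAtTwo
import Literature.NumberTheory.EllipticCurves.LambdaInvariantQuadraticTwistAtTwo
import Literature.NumberTheory.EllipticCurves.SelmerCorankControlRatOrdinaryProofs
import Literature.NumberTheory.EllipticCurves.Greenberg1999.SelmerCorankQuadraticTwistLambdaBoundProofs
import Literature.NumberTheory.EllipticCurves.KatoDivisibilityAllPrimes
import Literature.NumberTheory.EllipticCurves.KatoRankBoundAllPrimesProofs
import Literature.NumberTheory.EllipticCurves.KatoRankBoundLevelZeroProofs
import Literature.NumberTheory.EllipticCurves.PAdicLFunctionZeroAtMinusTwoProofs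
import Literature.NumberTheory.EllipticCurves.PAdicLFunctionIntegralityAtTwoProofs
import Literature.NumberTheory.EllipticCurves.PAdicLFunctionIntegralityAtTwoAutoProofs
import Literature.Barriers.BirchSwinnertonDyer.PAdicFunctionalEquationParityAnyPrimeProofs
import Summits.BirchSwinnertonDyer.Rank1Residual.X2.AnalyticInvariants
import HarnessLib

/-!
# The Matsuno bridge at the prime `2` — PART A (§0–§2): Nakayama at `(T)`, `μ/λ` bookkeeping in `Λ = ℤ₂⟦T⟧`,
# the pinch `μ(X) = 0 ∧ λ(X) = t ∧ 2ⁿ·Tᵗ·unit ∈ char X ⟹ char X = (Tᵗ)`, and (§3) the analytic door data ⟹ `L₂ = ι(T²·unit)`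

Planner p2 GEN 43 kernel (cell bsd-rank2, HOME/p2/g43/lean/MatsunoBridgeAtTwo.lean v3, sha 27cbfdf0; `lean check` rc 0 / 0 sorry), split into three
tree files by the lead star-p1 GEN 18 at the planner's LANDING ASK (Part A = this file, §0–§3; Part B `MatsunoBridgeAtTwoBridge` = §4–§5
the base curve and THE BRIDGE; Part C `MatsunoBridgeAtTwoDichotomy` = §6–§8 conductor level, the door wired, `μ = 0` from integral
Kato, the dichotomy).  The full mathematical commentary of the planner's file is reproduced in Part B's docstring.  This part is PURE IWASAWA
ALGEBRA over `Λ = ℤ_p⟦T⟧`: `one_le_coinvariantsRank_of_lengthAt_primeT_ne_zero` (`T ∣ f_X ⟹ rank_{ℤ_p} X/TX ≥ 1`, Cayley–Hamilton/Nakayama at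
the prime `(T)`, no semisimplicity), `μ`/`λ` of `Tᵗ·unit` and `pⁿ`, and `charIdeal_eq_span_X_pow_of_kato_element` (the pinch); plus §3
`exists_unit_eq_X_sq_mul_of_chi8Floor`: the χ₈-floor analytic door data (`2 ≤ ord_T L₂(A)`, `v₂(S₈(A)) = 2`, integrality at `2`) give `L₂(A) = ι(T²·unit)`
[cite: MazurTateTeitelbaum1986Invent, §I.12–I.14].
Theorems only; no definition, no named fact, no instance; nothing here reads `r_an`; BSD is not proved (B1).

## References
* L. Washington, GTM 83, §7.1, §13.2 (structure of `Λ`-modules, `μ`, `λ`, characteristic ideals). [Washington1997]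
* R. Greenberg, LNM 1716 (1999), Thm. 1.2, Lemma 3.1. [GreenbergLNM1716]
* K. Kato, Astérisque 295 (2004), Thm. 17.4 (1)(2). [Kato2004Asterisque]
-/

set_option autoImplicit false

noncomputable section

open scoped Classical MatrixGroups ModularForm

open CongruenceSubgroup WeierstrassCurve Literature.NumberTheory.EllipticCurves
  Literature.NumberTheory.EllipticCurves.ModularForms
  Literature.NumberTheory.EllipticCurves.IwasawaAlgebra
  Literature.NumberTheory.EllipticCurves.Rank1Residual
  Literature.NumberTheory.EllipticCurves.Rank1Residual.Typed
  Literature.NumberTheory.EllipticCurves.Greenberg1999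
  Summit.BirchSwinnertonDyer.BirchSwinnertonDyer.Theorems.Rank1ResidualX1Defs
  Summit.BirchSwinnertonDyer.Rank1Residual.X1.MuLambda
  Summit.BirchSwinnertonDyer.Rank1Residual.X1.MuPart
  Summit.BirchSwinnertonDyer.Rank1Residual.X1.ParitySqueeze
  Summit.BirchSwinnertonDyer.Rank1Residual.X1.RankOneParitySqueeze
  Summit.BirchSwinnertonDyer.Rank1Residual.X5
  Summit.BirchSwinnertonDyer.Rank1Residual.X5.O1

namespace Summit.BirchSwinnertonDyer.Rank2

/-! ### §0. Nakayama at the prime `(T)`: `T ∣ f_X ⟹ rank_{ℤ_p} X/TX ≥ 1` (no semisimplicity) -/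

section Nakayama

variable {p : ℕ} [Fact p.Prime] {M : Type*} [AddCommGroup M] [Module (IwasawaAlgebra p) M]

/-- **Cayley–Hamilton at `(T)`.** If a nonzero constant `c ∈ ℤ_p` multiplies `M` into `TM`
(`M` finitely generated over `Λ`), then `M_{(T)} = 0`: the endomorphism `c·` satisfies a monic
`q ∈ Λ[Y]` with non-leading coefficients in `(T)`, so `e := q(c) ∈ Λ` kills `M` and `e ≡ cⁿ ≢ 0 (mod T)`.
(The `(T)`-twin of the tree's `lengthAt_eq_zero_of_X_pow_smul_le_p_smul` at `(p)`.) [cite: Washington1997, §13.2] -/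
theorem lengthAt_primeT_eq_zero_of_C_smul_mem [Module.Finite (IwasawaAlgebra p) M] {c : ℤ_[p]}
    (hc : c ≠ 0)
    (h : ∀ m : M, (PowerSeries.C c : IwasawaAlgebra p) • m ∈
      Ideal.span {(PowerSeries.X : IwasawaAlgebra p)} • (⊤ : Submodule (IwasawaAlgebra p) M)) :
    Module.lengthAt (IwasawaAlgebra p) M (primeT p) = 0 := by
  set Λ' := IwasawaAlgebra p
  set I : Ideal Λ' := Ideal.span {(PowerSeries.X : Λ')} with hI
  set t : Λ' := PowerSeries.C c with ht
  let φ : Module.End Λ' M := Algebra.lsmul Λ' Λ' M t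
  have hφ : LinearMap.range φ ≤ I • (⊤ : Submodule Λ' M) := by
    rintro _ ⟨m, rfl⟩
    change t • m ∈ _
    exact h m
  obtain ⟨q, hmonic, -, hcoeff, hq⟩ :=
    LinearMap.exists_monic_and_natDegree_eq_and_coeff_mem_pow_and_aeval_eq_zero Λ' φ I hφ
  set e : Λ' := Polynomial.aeval t q with he
  have heM : Module.IsTorsionBy Λ' M e := by
    intro m
    have h1 : Polynomial.aeval φ q = Algebra.lsmul Λ' Λ' M e := by
      rw [he, show φ = Algebra.lsmul Λ' Λ' M t from rfl, Polynomial.aeval_algHom_apply]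
    have h2 := LinearMap.congr_fun hq m
    rw [h1] at h2
    simpa using h2
  -- `e - cⁿ ∈ (T)` and `cⁿ ∉ (T)`
  have het : e - t ^ q.natDegree ∈ I := by
    rw [he, Polynomial.aeval_eq_sum_range, Finset.sum_range_succ, hmonic.coeff_natDegree, one_smul,
      add_sub_cancel_right]
    refine Submodule.sum_mem _ fun i hi => ?_
    rw [Finset.mem_range] at hi
    have hci : q.coeff i ∈ I := Ideal.pow_le_self (by omega) (hcoeff i)
    rw [smul_eq_mul]
    exact Ideal.mul_mem_right _ _ hci
  have hen : e ∉ I := by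
    intro hein
    have htn : t ^ q.natDegree ∈ I := by
      have := Submodule.sub_mem _ hein het
      rwa [sub_sub_cancel] at this
    rw [hI, mem_span_X_iff, ht, ← map_pow, PowerSeries.constantCoeff_C] at htn
    exact pow_ne_zero _ hc htn
  exact Module.lengthAt_eq_zero_of_isTorsionBy heM (primeT p) (by rwa [primeT_asIdeal])

/-- **`length_{Λ_(T)} M_(T) ≠ 0 ⟹ rank_{ℤ_p} M/TM ≥ 1`** for a finitely generated `Λ`-module `M`
(Nakayama at `(T)`; NO `T`-semisimplicity): if `rank_{ℤ_p} M/TM = 0` then the finitely generated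
`ℤ_p`-module `M/TM` is torsion, killed by some `c ≠ 0`, i.e. `c·M ⊆ TM`, and
`lengthAt_primeT_eq_zero_of_C_smul_mem` gives `M_{(T)} = 0`. In particular `T ∣ f_X` forces
`rank_{ℤ_p} X/TX ≥ 1`. [cite: Washington1997, §13.2] [cite: GreenbergLNM1716, §1 p. 60] -/
theorem one_le_coinvariantsRank_of_lengthAt_primeT_ne_zero [Module.Finite (IwasawaAlgebra p) M]
    (h : Module.lengthAt (IwasawaAlgebra p) M (primeT p) ≠ 0) : 1 ≤ coinvariantsRank p M := by
  by_contra hlt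
  have h0 : coinvariantsRank p M = 0 := by omega
  letI : Module ℤ_[p] (coinvariants p M) := Module.compHom _ (algebraMap ℤ_[p] (IwasawaAlgebra p))
  haveI : Module.Finite ℤ_[p] (coinvariants p M) := finite_int_coinvariants p M
  rw [coinvariantsRank_eq_finrank_int] at h0
  have htors : Module.IsTorsion ℤ_[p] (coinvariants p M) :=
    Module.finrank_eq_zero_iff_isTorsion.mp h0
  obtain ⟨c, hc, hc0⟩ := Submodule.annihilator_top_inter_nonZeroDivisors htors
  refine h (lengthAt_primeT_eq_zero_of_C_smul_mem (nonZeroDivisors.ne_zero hc0) fun m => ?_)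
  have h1 : c • (Submodule.Quotient.mk m : coinvariants p M) = 0 :=
    Submodule.mem_annihilator.mp hc _ Submodule.mem_top
  have h2 : c • (Submodule.Quotient.mk m : coinvariants p M) =
      Submodule.Quotient.mk ((PowerSeries.C c : IwasawaAlgebra p) • m) := by
    change (algebraMap ℤ_[p] (IwasawaAlgebra p) c) • (Submodule.Quotient.mk m : coinvariants p M) = _
    rw [Submodule.Quotient.mk_smul, PowerSeries.algebraMap_eq]
  rw [h2, Submodule.Quotient.mk_eq_zero] at h1
  exact h1

end Nakayama

/-! ### §1. `μ`/`λ` bookkeeping in `Λ = ℤ_p⟦T⟧` -/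

section Algebra

variable {p : ℕ} [Fact p.Prime]

/-- `μ(g) = 0` as soon as `g ≢ 0 (mod p)`. [cite: Washington1997, §7.1] -/
theorem mu_eq_zero_of_red_ne_zero {g : IwasawaAlgebra p} (h : red g ≠ 0) : mu g = 0 :=
  (mu_eq_and_pfree_eq h (by simp)).1

/-- `λ(Tᵗ·v) = t` for a unit `v`. [cite: Washington1997, §7.1] -/
theorem lam_X_pow_mul_unit (t : ℕ) (v : (IwasawaAlgebra p)ˣ) :
    lam ((PowerSeries.X : IwasawaAlgebra p) ^ t * (v : IwasawaAlgebra p)) = t := by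
  rw [lam_mul (pow_ne_zero _ PowerSeries.X_ne_zero) v.ne_zero, lam_pow PowerSeries.X_ne_zero, Rank1Residual.X2.lam_X,
    lam_eq_zero_of_isUnit v.isUnit]
  simp

/-- `Tᵗ·v ≢ 0 (mod p)` for a unit `v`, hence `μ(Tᵗ·v) = 0`. [cite: Washington1997, §7.1] -/
theorem red_X_pow_mul_unit_ne_zero (t : ℕ) (v : (IwasawaAlgebra p)ˣ) :
    red ((PowerSeries.X : IwasawaAlgebra p) ^ t * (v : IwasawaAlgebra p)) ≠ 0 := by
  rw [red, map_mul, map_pow, PowerSeries.map_X]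
  refine mul_ne_zero (pow_ne_zero _ PowerSeries.X_ne_zero) ?_
  exact (v.isUnit.map (PowerSeries.map (IsLocalRing.residue ℤ_[p]))).ne_zero

/-- `μ(pⁿ) = n`. [cite: Washington1997, §7.1] -/
theorem mu_C_pow (n : ℕ) : mu (PowerSeries.C ((p : ℤ_[p]) ^ n) : IwasawaAlgebra p) = n :=
  (mu_eq_and_pfree_eq (g₀ := (1 : IwasawaAlgebra p)) (a := n)
    (by rw [red, map_one]; exact one_ne_zero) (by rw [mul_one])).1

/-- `Tᵗ · v = Tᵗ · w'`-type bookkeeping: a power series whose first `t` coefficients vanish and whose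
`t`-th coefficient is a unit is `Tᵗ` times a unit. [cite: Washington1997, §7.1] -/
theorem exists_unit_eq_X_pow_mul {L : IwasawaAlgebra p} {t : ℕ}
    (h0 : ∀ i < t, PowerSeries.coeff i L = 0) (ht : IsUnit (PowerSeries.coeff t L)) :
    ∃ v : (IwasawaAlgebra p)ˣ, L = (PowerSeries.X : IwasawaAlgebra p) ^ t * (v : IwasawaAlgebra p) := by
  obtain ⟨M, hM⟩ : (PowerSeries.X : IwasawaAlgebra p) ^ t ∣ L := PowerSeries.X_pow_dvd_iff.mpr h0
  have hc : PowerSeries.constantCoeff M = PowerSeries.coeff t L := by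
    rw [hM, PowerSeries.coeff_X_pow_mul', if_pos le_rfl, Nat.sub_self,
      PowerSeries.coeff_zero_eq_constantCoeff]
  have hMu : IsUnit M := PowerSeries.isUnit_iff_constantCoeff.mpr (hc ▸ ht)
  exact ⟨hMu.unit, by rw [IsUnit.unit_spec]; exact hM⟩

end Algebra

/-! ### §2. The pinch: `μ(X) = 0`, `λ(X) = t` and a Kato element `pⁿ·Tᵗ·unit ∈ char X` force `char X = (Tᵗ)` -/

section Pinch

variable (p : ℕ) [Fact p.Prime] {Y : Type*} [AddCommGroup Y] [Module (IwasawaAlgebra p) Y]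

/-- **`char_Λ X = (Tᵗ)` from `μ(X) = 0`, `λ(X) = t` and a Kato element.** For a finitely generated
torsion `Λ`-module `X` with `μ(X) = 0`, `λ(X) = t`, and `g = pⁿ·Tᵗ·v ∈ char_Λ X` (`v` a unit):
`char_Λ X = (Tᵗ)`. With `f_X` a generator (`char X` is principal), `μ(f_X) = μ(X) = 0`,
`λ(f_X) = λ(X) = t`; `g = f_X·h` gives `λ(h) = 0`, `μ(h) = n`, so `h = pⁿ·w` with `w` a unit
(`Λˣ = {μ = λ = 0}`), and cancelling `pⁿ` in the domain `Λ`: `Tᵗ·v = f_X·w`.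
[cite: Washington1997, §7.1 and §13.2] [cite: GreenbergVatsal2000, p. 4] -/
theorem charIdeal_eq_span_X_pow_of_kato_element [Module.Finite (IwasawaAlgebra p) Y]
    (hY : Module.IsTorsion (IwasawaAlgebra p) Y) {t : ℕ} (hμ : muInvariant p Y = 0)
    (hl : lambdaInvariant p Y = t) {n : ℕ} {v : (IwasawaAlgebra p)ˣ} {g : IwasawaAlgebra p}
    (hg : g ∈ Module.charIdeal (IwasawaAlgebra p) Y)
    (hgv : g = PowerSeries.C ((p : ℤ_[p]) ^ n) * ((PowerSeries.X : IwasawaAlgebra p) ^ t * (v : IwasawaAlgebra p))) :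
    Module.charIdeal (IwasawaAlgebra p) Y = Ideal.span {(PowerSeries.X : IwasawaAlgebra p) ^ t} := by
  haveI : (Module.charIdeal (IwasawaAlgebra p) Y).IsPrincipal := charIdeal_isPrincipal_holds p Y
  obtain ⟨f, hf⟩ := Submodule.IsPrincipal.principal (Module.charIdeal (IwasawaAlgebra p) Y)
  have hchar : Module.charIdeal (IwasawaAlgebra p) Y = Ideal.span {f} := hf
  have hf0 : f ≠ 0 := by
    intro h0
    refine Module.charIdeal_ne_bot (IwasawaAlgebra p) Y ?_
    rw [hchar, h0]
    exact Ideal.span_singleton_eq_bot.mpr rfl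
  set Xt : IwasawaAlgebra p := (PowerSeries.X : IwasawaAlgebra p) ^ t * (v : IwasawaAlgebra p) with hXt
  have hXt0 : Xt ≠ 0 := mul_ne_zero (pow_ne_zero _ PowerSeries.X_ne_zero) v.ne_zero
  have hg0 : g ≠ 0 := by rw [hgv]; exact mul_ne_zero (C_pow_ne_zero n) hXt0
  -- `g = f · h`
  obtain ⟨h, hfh⟩ : ∃ h, g = f * h := by
    have : g ∈ Ideal.span {f} := hchar ▸ hg
    obtain ⟨a, ha⟩ := Ideal.mem_span_singleton'.mp this
    exact ⟨a, by rw [← ha, mul_comm]⟩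
  have hh0 : h ≠ 0 := by rintro rfl; exact hg0 (by rw [hfh, mul_zero])
  -- `λ`, `μ` of `f`, `g`, `h`
  have hlamf : lam f = t := by rw [lam_generator_eq_lambdaInvariant Y hY hf0 hchar, hl]
  have hmuf : mu f = 0 := by rw [mu_generator_eq_muInvariant Y hY hf0 hchar, hμ]
  have hlamg : lam g = t := by rw [hgv, lam_C_pow_mul n hXt0, hXt, lam_X_pow_mul_unit]
  have hmug : mu g = n := by
    rw [hgv, mu_mul (C_pow_ne_zero n) hXt0, mu_C_pow, mu_eq_zero_of_red_ne_zero
      (red_X_pow_mul_unit_ne_zero t v), add_zero]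
  have hlamh : lam h = 0 := by
    have := lam_mul hf0 hh0; rw [← hfh, hlamg, hlamf] at this; omega
  have hmuh : mu h = n := by
    have := mu_mul hf0 hh0; rw [← hfh, hmug, hmuf] at this; omega
  -- `h = pⁿ · w`, `w` a unit
  set w := pfree h with hw
  have hhw : h = PowerSeries.C ((p : ℤ_[p]) ^ n) * w := by rw [hw, ← hmuh]; exact eq_C_pow_mu_mul_pfree h
  have hw' := mu_eq_and_pfree_eq (g := w) (g₀ := w) (a := 0) (red_pfree_ne_zero hh0) (by simp)
  have hwu : IsUnit w := by
    rw [isUnit_iff_mu_eq_zero_and_lam_eq_zero]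
    refine ⟨pfree_ne_zero hh0, hw'.1, ?_⟩
    -- `λ(w) = λ(h) = 0` (same `p`-free part)
    rw [lam, hw'.2]
    rw [lam] at hlamh
    exact hlamh
  -- cancel `pⁿ`: `Tᵗ·v = f·w`
  have hcancel : Xt = f * w := by
    apply mul_left_cancel₀ (C_pow_ne_zero (p := p) n)
    rw [← hgv, hfh, hhw]; ring
  calc Module.charIdeal (IwasawaAlgebra p) Y = Ideal.span {f} := hchar
    _ = Ideal.span {f * w} := (Ideal.span_singleton_mul_right_unit hwu f).symm
    _ = Ideal.span {Xt} := by rw [hcancel]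
    _ = Ideal.span {(PowerSeries.X : IwasawaAlgebra p) ^ t} := by
        rw [hXt]; exact Ideal.span_singleton_mul_right_unit v.isUnit _

/-- **Consequences of `char_Λ X = (Tᵗ)`** for a finitely generated torsion `Λ`-module: every generator
has `ord_T = t`; `length_{Λ_(T)} X_(T) = t`; `rank_{ℤ_p} X/TX ≤ t`; and, if `t ≠ 0`, `rank_{ℤ_p} X/TX ≥ 1`
(§0). [cite: Washington1997, §13.2] -/
theorem order_lengthAt_coinvariantsRank_of_charIdeal_eq_span_X_pow [Module.Finite (IwasawaAlgebra p) Y]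
    (hY : Module.IsTorsion (IwasawaAlgebra p) Y) {t : ℕ}
    (hchar : Module.charIdeal (IwasawaAlgebra p) Y = Ideal.span {(PowerSeries.X : IwasawaAlgebra p) ^ t}) :
    (∀ f : IwasawaAlgebra p, Module.charIdeal (IwasawaAlgebra p) Y = Ideal.span {f} → f.order = t) ∧
      Module.lengthAt (IwasawaAlgebra p) Y (primeT p) = t ∧ (coinvariantsRank p Y : ℕ∞) ≤ t ∧
      (t ≠ 0 → 1 ≤ coinvariantsRank p Y) := by
  have hordXt : ((PowerSeries.X : IwasawaAlgebra p) ^ t).order = t := PowerSeries.order_X_pow t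
  have hlen : Module.lengthAt (IwasawaAlgebra p) Y (primeT p) = t := by
    have h1 := order_eq_toNat_lengthAt p hY _ hchar (primeT p) (primeT_asIdeal p)
    rw [hordXt] at h1
    have hne : Module.lengthAt (IwasawaAlgebra p) Y (primeT p) ≠ ⊤ := lengthAt_primeT_ne_top Y hY
    rw [← ENat.coe_toNat hne]
    exact_mod_cast (by exact_mod_cast h1.symm : (Module.lengthAt (IwasawaAlgebra p) Y (primeT p)).toNat = t)
  refine ⟨fun f hf ↦ ?_, hlen, ?_, fun ht ↦ ?_⟩
  · have hassoc : Associated ((PowerSeries.X : IwasawaAlgebra p) ^ t) f :=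
      Ideal.span_singleton_eq_span_singleton.mp (hchar.symm.trans hf)
    obtain ⟨u, hu⟩ := hassoc
    rw [← hu, PowerSeries.order_mul, hordXt, PowerSeries.order_zero_of_unit u.isUnit, add_zero]
  · have hmem : (PowerSeries.X : IwasawaAlgebra p) ^ t ∈ Module.charIdeal (IwasawaAlgebra p) Y := by
      rw [hchar]; exact Ideal.mem_span_singleton_self _
    have := coinvariantsRank_le_order_of_mem_charIdeal Y hY _ hmem
    rwa [hordXt] at this
  · refine one_le_coinvariantsRank_of_lengthAt_primeT_ne_zero ?_
    rw [hlen]; exact_mod_cast ht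

end Pinch

/-! ### §3. The analytic door data ⟹ `L₂ = ι(T²·unit)` (`λ^{an} = 2`, `μ^{an} = 0`, `ord_T = 2`) -/

section Analytic

variable {W : WeierstrassCurve ℚ} [W.IsElliptic] [W.IsGloballyMinimal] {N : ℕ} [NeZero N]
  {f : CuspForm (Gamma0 N) 2}

/-- `‖−2‖ = 1/2` in `ℂ₂`. [folklore] -/
private theorem norm_neg_two_padicComplex' : ‖(-2 : ℂ_[2])‖ = (2 : ℝ)⁻¹ := by
  have h2 : (2 : ℂ_[2]) = algebraMap ℚ_[2] ℂ_[2] ((2 : ℕ) : ℚ_[2]) := by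
    rw [map_natCast]; norm_num
  rw [norm_neg, h2, norm_algebraMap', Padic.norm_p]
  norm_num

/-- **The χ₈-floor pins the `T²`-coefficient.** `E = W` globally minimal, good ordinary at `2`, `f` a
newform of `E`, `L ∈ Λ` with `ι L = L₂(f, α, T)`; if `ord_{T=0} L₂ ≥ 2` and `v₂(S₈(f)) ≤ 2`
(`‖S₈(f)‖₂ > 2⁻³`), then the coefficient `c₂` of `L` is a `2`-adic unit: otherwise every term of
`Σ c_k(−2)^k = α⁻³ S₈(f)` has norm `≤ 2⁻³`. [cite: MazurTateTeitelbaum1986Invent, §I.14 Proposition (p. 20)] -/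
theorem isUnit_coeff_two_of_chi8Floor (hord : IsOrdinaryAt W 2) (hf : IsNewformOf W f)
    {L : IwasawaAlgebra 2}
    (hL : iwasawaToPowerSeries 2 L = padicLFunction f (unitRoot W 2 : ℚ_[2]))
    (h2 : (2 : ℕ∞) ≤ (padicLFunction f (unitRoot W 2 : ℚ_[2])).order)
    (hS : (2 : ℝ)⁻¹ ^ 3 <
      ‖((ratTwistedSymbolSum f (ZMod.χ₈.ringHomComp (Int.castRingHom ℚ)) : ℚ) : ℚ_[2])‖) :
    IsUnit (PowerSeries.coeff 2 L) := by
  by_contra hnu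
  have hcoeffk : ∀ k : ℕ, PowerSeries.coeff k (padicLFunction f (unitRoot W 2 : ℚ_[2])) =
      ((PowerSeries.coeff k L : ℤ_[2]) : ℚ_[2]) := by
    intro k; rw [← hL, PowerSeries.coeff_map, PadicInt.algebraMap_apply]
  -- `‖c₂‖ ≤ 1/2`
  have hc2 : ‖((PowerSeries.coeff 2 L : ℤ_[2]) : ℚ_[2])‖ ≤ (2 : ℝ)⁻¹ := by
    have hlt : ‖(PowerSeries.coeff 2 L : ℤ_[2])‖ < 1 :=
      lt_of_le_of_ne (PadicInt.norm_le_one _) (fun h ↦ hnu (PadicInt.isUnit_iff.mpr h))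
    obtain ⟨y, hy⟩ := (PadicInt.norm_lt_one_iff_dvd _).mp hlt
    rw [← PadicInt.norm_def, hy, norm_mul, PadicInt.norm_p]
    have := PadicInt.norm_le_one y
    calc ((2 : ℕ) : ℝ)⁻¹ * ‖y‖ ≤ ((2 : ℕ) : ℝ)⁻¹ * 1 := by gcongr
      _ = (2 : ℝ)⁻¹ := by norm_num
  -- the coefficients `c₀, c₁` vanish
  have hcoeff : ∀ k : ℕ, k < 2 → PowerSeries.coeff k (padicLFunction f (unitRoot W 2 : ℚ_[2])) = 0 :=
    fun k hk ↦ PowerSeries.coeff_of_lt_order k (lt_of_lt_of_le (by exact_mod_cast hk) h2)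
  have hα : ‖(unitRoot W 2 : ℚ_[2])‖ = 1 := (unitRoot_coe_spec (W := W) hord).2.1
  have hterm : ∀ k : ℕ,
      ‖algebraMap ℚ_[2] ℂ_[2] (PowerSeries.coeff k (padicLFunction f (unitRoot W 2 : ℚ_[2]))) *
        (-2) ^ k‖ ≤ (2 : ℝ)⁻¹ ^ 3 := by
    intro k
    by_cases hk : k < 2
    · rw [hcoeff k hk, map_zero, zero_mul, norm_zero]; positivity
    · push Not at hk
      rw [norm_mul, norm_pow, norm_algebraMap', norm_neg_two_padicComplex', hcoeffk k]
      rcases Nat.lt_or_ge k 3 with hk3 | hk3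
      · have hk2 : k = 2 := by omega
        subst hk2
        calc ‖((PowerSeries.coeff 2 L : ℤ_[2]) : ℚ_[2])‖ * (2 : ℝ)⁻¹ ^ 2
            ≤ (2 : ℝ)⁻¹ * (2 : ℝ)⁻¹ ^ 2 := by gcongr
          _ = (2 : ℝ)⁻¹ ^ 3 := by ring
      · have hc : ‖((PowerSeries.coeff k L : ℤ_[2]) : ℚ_[2])‖ ≤ 1 := by
          rw [← PadicInt.norm_def]; exact PadicInt.norm_le_one _
        have hp : ((2 : ℝ)⁻¹) ^ k ≤ (2 : ℝ)⁻¹ ^ 3 :=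
          pow_le_pow_of_le_one (by norm_num) (by norm_num) hk3
        calc ‖((PowerSeries.coeff k L : ℤ_[2]) : ℚ_[2])‖ * (2 : ℝ)⁻¹ ^ k ≤ 1 * (2 : ℝ)⁻¹ ^ 3 :=
              mul_le_mul hc hp (by positivity) (by positivity)
          _ = (2 : ℝ)⁻¹ ^ 3 := one_mul _
  have hsum := hasSum_coeff_padicLFunction_two_neg_two hord hf
  have hle : ‖algebraMap ℚ_[2] ℂ_[2] ((unitRoot W 2 : ℚ_[2])⁻¹ ^ 3) *
      ratTwistedSymbolSum f (ZMod.χ₈.ringHomComp (Int.castRingHom ℂ_[2]))‖ ≤ (2 : ℝ)⁻¹ ^ 3 := by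
    rw [← hsum.tsum_eq]
    exact IsUltrametricDist.norm_tsum_le_of_forall_le_of_nonneg (by positivity) hterm
  rw [norm_mul, norm_algebraMap', norm_pow, norm_inv, hα, inv_one, one_pow, one_mul,
    ratTwistedSymbolSum_χ₈_eq_cast f ℂ_[2],
    show (((ratTwistedSymbolSum f (ZMod.χ₈.ringHomComp (Int.castRingHom ℚ)) : ℚ) : ℂ_[2])) =
      algebraMap ℚ_[2] ℂ_[2]
        ((ratTwistedSymbolSum f (ZMod.χ₈.ringHomComp (Int.castRingHom ℚ)) : ℚ) : ℚ_[2]) by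
      rw [map_ratCast], norm_algebraMap'] at hle
  exact absurd hS (not_lt.mpr hle)

/-- **Door data ⟹ `L = T²·unit` in `Λ`** (`λ^{an}_2 = 2`, `μ^{an}_2 = 0`, `ord_T L₂ = 2`): with
`ι L = L₂(f, α, T)`, `ord_{T=0} L₂ ≥ 2` and the χ₈-floor `‖S₈(f)‖₂ > 2⁻³`, there is a unit `v ∈ Λˣ` with
`L = T²·v`. [cite: MazurTateTeitelbaum1986Invent, §I.14 Proposition (p. 20)] -/
theorem exists_unit_eq_X_sq_mul_of_chi8Floor (hord : IsOrdinaryAt W 2) (hf : IsNewformOf W f)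
    {L : IwasawaAlgebra 2}
    (hL : iwasawaToPowerSeries 2 L = padicLFunction f (unitRoot W 2 : ℚ_[2]))
    (h2 : (2 : ℕ∞) ≤ (padicLFunction f (unitRoot W 2 : ℚ_[2])).order)
    (hS : (2 : ℝ)⁻¹ ^ 3 <
      ‖((ratTwistedSymbolSum f (ZMod.χ₈.ringHomComp (Int.castRingHom ℚ)) : ℚ) : ℚ_[2])‖) :
    ∃ v : (IwasawaAlgebra 2)ˣ, L = (PowerSeries.X : IwasawaAlgebra 2) ^ 2 * (v : IwasawaAlgebra 2) := by
  refine exists_unit_eq_X_pow_mul (fun i hi ↦ ?_) (isUnit_coeff_two_of_chi8Floor hord hf hL h2 hS)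
  have h0 : PowerSeries.coeff i (padicLFunction f (unitRoot W 2 : ℚ_[2])) = 0 :=
    PowerSeries.coeff_of_lt_order i (lt_of_lt_of_le (by exact_mod_cast hi) h2)
  rw [← hL, PowerSeries.coeff_map, PadicInt.algebraMap_apply] at h0
  exact (PadicInt.coe_eq_zero).mp h0

/-- `ord_{T=0} ι(T²·v) = 2` for a unit `v`. [cite: MazurTateTeitelbaum1986Invent, §I.12] -/
theorem order_iwasawaToPowerSeries_X_sq_mul_unit (v : (IwasawaAlgebra 2)ˣ) :
    (iwasawaToPowerSeries 2 ((PowerSeries.X : IwasawaAlgebra 2) ^ 2 * (v : IwasawaAlgebra 2))).order = 2 := by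
  have hι : iwasawaToPowerSeries 2 ((PowerSeries.X : IwasawaAlgebra 2) ^ 2 * (v : IwasawaAlgebra 2)) =
      (PowerSeries.X : PowerSeries ℚ_[2]) ^ 2 * iwasawaToPowerSeries 2 (v : IwasawaAlgebra 2) := by
    rw [map_mul, map_pow, PowerSeries.map_X]
  have hvu : IsUnit (iwasawaToPowerSeries 2 (v : IwasawaAlgebra 2)) := v.isUnit.map _
  rw [hι, PowerSeries.order_mul, PowerSeries.order_X_pow, PowerSeries.order_zero_of_unit hvu, add_zero]
  rfl

end Analytic

end Summit.BirchSwinnertonDyer.Rank2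

end
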